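import Summits.RiemannHypothesis.RiemannHypothesis.Theorems.LeeYangLeeyangThesisB1Exist
import Summits.RiemannHypothesis.RiemannHypothesis.Theorems.LeeYangLeeyangThesisCalBound
import Summits.RiemannHypothesis.RiemannHypothesis.Theorems.LeeYangLeeyangThesisStubCalGrowth
import Literature.Analysis.InverseSpectral.KreinStringWeylAnalytic
import HarnessLib

/-!
# RiemannHypothesis / LeeYang — crux `LeeyangThesis`, line `Sketch`: the calibration member

**An explicit Ising limit law with ξ-type transfer growth (RH-free).** The Kreĭn string of length
`L` with density `1/((L-y)² log²(A/(L-y)))` on `[0, L)` (`A ≥ e·L`; "freezing heavy end":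
`m(L-) = ∞`, infinite travel time, finite first moment) has real end values
`F(r) = lim_{x → L⁻} Re φ(x, -r²)` for every real `r`, with `F(r) ≤ (u₀/u_L)^r (1 + 2r)` for `r > 0`
(`log F(r) = O(r log r)`), and there is a probability law `ν` on `ℝ` — an ISING LIMIT LAW with all
Gaussian moments — whose two-sided Laplace transform is `F` (`stub_calMember`). This is the first
certified member of the Griffiths–Simon class whose transform has the growth order of `ξ`
(between the compactly supported laws, `log F ≍ r`, and Newman's `Λ = -∞` class, `log F ≍ r^{4/3}`):
finite ferromagnetic spin-½ chains DO reach doubly-exponential tails. Ingredients: `stub_calBound`,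
`stub_calGrowth`, `exists_isingLimitLaw_of_string`, monotone limits along the end filter.
-/

noncomputable section

-- single-problem summit namespace `Summit.RiemannHypothesis.RiemannHypothesis.…` (D-0017)
set_option linter.dupNamespace false

open MeasureTheory Filter Topology Complex Set
open scoped ENNReal
open Literature.Analysis.InverseSpectral Literature.Probability.LatticeModels

namespace Summit.RiemannHypothesis.RiemannHypothesis.Theorems.LeeYangTelegraphString

/-- **Stub calMember — the calibration string defines an Ising limit law with ξ-type growth.**
[folklore] -/
theorem stub_calMember : ∀ (L A : ℝ), 0 < L → Real.exp 1 * L ≤ A →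
    ∀ S : KreinString, S.length = ENNReal.ofReal L →
    S.massMeasure = (volume.withDensity fun y => ENNReal.ofReal
      ((fun y : ℝ => if 0 ≤ y ∧ y < L then 1 / ((L - y) ^ 2 * Real.log (A / (L - y)) ^ 2) else 0) y)).restrict
      (Set.Iio L) →
    ∃ ν : ProbabilityMeasure ℝ, IsIsingLimitLaw ν ∧
      (∀ b : ℝ, Integrable (fun u : ℝ => Real.exp (b * u ^ 2)) (ν : Measure ℝ)) ∧
      (∀ r : ℝ, Tendsto (fun x => (S.phi (-((r ^ 2 : ℝ) : ℂ)) x).re) S.toEnd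
        (𝓝 (∫ u, Real.exp (r * u) ∂(ν : Measure ℝ)))) ∧
      ∀ r : ℝ, 0 < r → ∫ u, Real.exp (r * u) ∂(ν : Measure ℝ) ≤
        (max (Real.log (A / L)) (2 + r + 2 * r ^ 2) / Real.log (A / L)) ^ r * (1 + 2 * r) := by
  intro L A hL hA S hlen hmass
  set ρ : ℝ → ℝ := fun y : ℝ => if 0 ≤ y ∧ y < L then
    1 / ((L - y) ^ 2 * Real.log (A / (L - y)) ^ 2) else 0 with hρ
  obtain ⟨hρmeas, hρmono, -, -, -⟩ := stub_calDensity L A hL hA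
  have hρ0 : ∀ y < 0, ρ y = 0 := fun y hy => by
    simp only [hρ, if_neg (show ¬(0 ≤ y ∧ y < L) from fun h => absurd h.1 (not_le.2 hy))]
  have hA0 : 0 < A := lt_of_lt_of_le (by positivity) hA
  have huL : 1 ≤ Real.log (A / L) := by
    rw [Real.le_log_iff_exp_le (div_pos hA0 hL), le_div_iff₀ hL]
    exact hA
  -- the explicit bound `B`
  set B : ℝ → ℝ := fun r => (max (Real.log (A / L)) (2 + r + 2 * r ^ 2) / Real.log (A / L)) ^ r *
    (1 + 2 * r) with hB
  have hbound : ∀ r : ℝ, 0 < r → ∀ y ∈ Ico 0 L, (S.phi (-((r ^ 2 : ℝ) : ℂ)) y).re ≤ B r :=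
    fun r hr y hy => stub_calBound L A r hL hA hr S hlen hmass y hy
  have hdom : ∀ {y : ℝ}, y ∈ S.dom ↔ 0 ≤ y ∧ y < L := by
    intro y
    rw [KreinString.mem_dom, hlen, ENNReal.ofReal_lt_ofReal_iff hL]
  -- uniform majorant for every real `r`: the bound at `|r| + 1`
  have hmaj : ∀ (r : ℝ), ∀ y ∈ Ico 0 L, (S.phi (-((r ^ 2 : ℝ) : ℂ)) y).re ≤ B (|r| + 1) := by
    intro r y hy
    have h1 : (S.phi (-((r ^ 2 : ℝ) : ℂ)) y).re ≤ (S.phi (-(((|r| + 1) ^ 2 : ℝ) : ℂ)) y).re :=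
      S.phi_neg_re_mono_param (hdom.2 ⟨hy.1, hy.2⟩) (sq_nonneg r)
        (by rw [← sq_abs r]; nlinarith [sq_nonneg (|r| - 1), abs_nonneg r])
    exact h1.trans (hbound (|r| + 1) (by positivity) y hy)
  -- the real end values as suprema of a monotone function
  have htoEnd : S.toEnd = 𝓝[<] L := by
    simp [KreinString.toEnd, hlen, ENNReal.toReal_ofReal hL.le]
  set F : ℝ → ℝ := fun r => sSup ((fun x => (S.phi (-((r ^ 2 : ℝ) : ℂ)) (max x 0)).re) '' Iio L) with hF
  have hmonof : ∀ r : ℝ, MonotoneOn (fun x => (S.phi (-((r ^ 2 : ℝ) : ℂ)) (max x 0)).re) (Iio L) := by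
    intro r x hx x' hx' hxx'
    exact S.monotoneOn_phi_neg_re (sq_nonneg r) (hdom.2 ⟨le_max_right _ _, max_lt hx hL⟩)
      (hdom.2 ⟨le_max_right _ _, max_lt hx' hL⟩) (max_le_max hxx' le_rfl)
  have hbddf : ∀ r : ℝ, BddAbove ((fun x => (S.phi (-((r ^ 2 : ℝ) : ℂ)) (max x 0)).re) '' Iio L) := by
    intro r
    refine ⟨B (|r| + 1), ?_⟩
    rintro _ ⟨x, hx, rfl⟩
    exact hmaj r (max x 0) ⟨le_max_right _ _, max_lt hx hL⟩
  have hne : (Iio L).Nonempty := ⟨0, hL⟩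
  have hFlim : ∀ r : ℝ, Tendsto (fun x => (S.phi (-((r ^ 2 : ℝ) : ℂ)) x).re) S.toEnd (𝓝 (F r)) := by
    intro r
    have h1 := (hmonof r).tendsto_nhdsLT (hbddf r)
    rw [htoEnd]
    refine h1.congr' ?_
    have : ∀ᶠ x in 𝓝[<] L, (0 : ℝ) < x := by
      have h := Ioo_mem_nhdsLT hL
      filter_upwards [h] with x hx using hx.1
    filter_upwards [this] with x hx
    simp only [max_eq_left hx.le]
  have hFle : ∀ r : ℝ, F r ≤ B (|r| + 1) := by
    intro r
    refine csSup_le (hne.image _) ?_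
    rintro _ ⟨x, hx, rfl⟩
    exact hmaj r (max x 0) ⟨le_max_right _ _, max_lt hx hL⟩
  have hFleB : ∀ r : ℝ, 0 < r → F r ≤ B r := by
    intro r hr
    refine csSup_le (hne.image _) ?_
    rintro _ ⟨x, hx, rfl⟩
    exact hbound r hr (max x 0) ⟨le_max_right _ _, max_lt hx hL⟩
  -- sub-Gaussian growth at every rate
  have hgrowth : ∀ b : ℝ, 0 < b → ∃ C : ℝ, ∀ r : ℝ, F r ≤ C * Real.exp (b * r ^ 2) := by
    intro b hb
    obtain ⟨C, hC⟩ := stub_calGrowth (Real.log (A / L)) (b / 2) huL (by positivity)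
    have hC0 : 0 ≤ C := by
      have h := hC 0 le_rfl
      have hB0 : B 0 = 1 := by simp [hB]
      have : (1 : ℝ) ≤ C * Real.exp (b / 2 * 0 ^ 2) := by
        have := hC 0 le_rfl
        simpa [hB] using this
      simp at this
      linarith
    refine ⟨C * Real.exp b, fun r => (hFle r).trans ?_⟩
    have h := hC (|r| + 1) (by positivity)
    refine h.trans ?_
    rw [mul_assoc, ← Real.exp_add]
    refine mul_le_mul_of_nonneg_left (Real.exp_le_exp.2 ?_) hC0
    have hsq : (|r| + 1) ^ 2 ≤ 2 * r ^ 2 + 2 := by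
      rw [← sq_abs r]; nlinarith [sq_nonneg (|r| - 1), abs_nonneg r]
    calc b / 2 * (|r| + 1) ^ 2 ≤ b / 2 * (2 * r ^ 2 + 2) := by gcongr
      _ = b + b * r ^ 2 := by ring
  -- B1-existence
  obtain ⟨ν, hIsing, hmom, hLap⟩ := exists_isingLimitLaw_of_string S L ρ hL hρmeas hρmono hρ0 hlen
    hmass F hFlim hgrowth
  refine ⟨ν, hIsing, hmom, fun r => ?_, fun r hr => ?_⟩
  · rw [hLap r]; exact hFlim r
  · rw [hLap r]; exact hFleB r hr

end Summit.RiemannHypothesis.RiemannHypothesis.Theorems.LeeYangTelegraphString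

end
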